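import Mathlib
import HarnessLib
import Summits.Ventures.LatticeQCDFlow.Exactness.FlowPushforward

/-!
# Jacobians under restriction to an invariant piece and under a change of the reference density

HONEST FRAMING: exact (Metropolis-corrected) sampling algorithms for lattice gauge theory;
figures of merit are autocorrelation/cost numbers at stated couplings and volumes; no
continuum-physics claim.

Venture `LatticeQCDFlow` (cell pub-lqcd), topic `Exactness`; FANOUT row 10 (`eng-equiv`, engine
`latflow.equiv` `spectral.spectral_kernel`: the booked log-det carries the CHART terms
`+ logdet dφ(α') − logdet dφ(α)` of the stick-breaking map `φ : box → simplex` (Boyda et al. 2021,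
App. B Algorithm 2, eqs. (22)–(24)) — exactly the correction of a Jacobian when the reference measure
is changed by a density — and the flow is certified chamber by chamber).  NEW WORK of the cell over
`FlowPushforward.lean` (`HasJacobian`, `HasJacobian.map_withDensity`); pure measure theory; nothing
is cited as a fact; no number; no definition.

## What is typed (`F : Ω → Ω`, reference measure `μ`)

* **`HasJacobian.restrict_of_preimage_eq`** — if `F` has Jacobian `J` for `μ` and `S` is measurable
  with `F ⁻¹' S = S`, then `F` has Jacobian `J` for `μ|S` (one Weyl chamber at a time);
* **`HasJacobian.withDensity_of_pos`** — if `F` has Jacobian `J` for `μ` and `D` is a measurable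
  density with `0 < D < ∞`, then `F` has Jacobian `z ↦ D(F z) · J z / D z` for `D · μ`: the booked
  log-det acquires `+ log D(F z) − log D(z)` (the engine's `ld_phi_out − ld_phi_in`, and the
  Haar/Vandermonde terms `log_haar(x') − log_haar(x)` are the same mechanism);
* `HasJacobian.withDensity_of_pos_ae` — the same with `0 < D < ∞` only `μ`-a.e.

NOT here: the stick-breaking map itself; any number.
-/

noncomputable section

namespace Summit.Ventures.LatticeQCDFlow.Exactness

open MeasureTheory Set
open scoped ENNReal

variable {Ω : Type*} [MeasurableSpace Ω] {μ : Measure Ω} {F : Ω → Ω} {J : Ω → ℝ≥0∞}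

/-- **Restriction to an invariant piece.**  If `F` has Jacobian `J` for `μ` and `F ⁻¹' S = S` for a
measurable `S`, then `F` has Jacobian `J` for `μ|S`. -/
theorem HasJacobian.restrict_of_preimage_eq (h : HasJacobian μ F J) {S : Set Ω} (hS : MeasurableSet S)
    (hFS : F ⁻¹' S = S) : HasJacobian (μ.restrict S) F J where
  measurable := h.measurable
  measurable_jac := h.measurable_jac
  map_eq := by
    rw [← restrict_withDensity hS]
    conv_lhs => rw [← hFS]
    rw [← Measure.restrict_map h.measurable hS, h.map_eq]

/-- **Change of the reference density.**  If `F` has Jacobian `J` for `μ` and `D` is measurable with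
`0 < D z < ∞` for every `z`, then `F` has Jacobian `z ↦ D (F z) · J z / D z` for `D · μ`. -/
theorem HasJacobian.withDensity_of_pos (h : HasJacobian μ F J) {D : Ω → ℝ≥0∞} (hD : Measurable D)
    (hD0 : ∀ z, D z ≠ 0) (hDtop : ∀ z, D z ≠ ∞) :
    HasJacobian (μ.withDensity D) F fun z => D (F z) * J z / D z where
  measurable := h.measurable
  measurable_jac := ((hD.comp h.measurable).mul h.measurable_jac).div hD
  map_eq := by
    have hm : Measurable fun z => D (F z) * J z / D z := ((hD.comp h.measurable).mul h.measurable_jac).div hD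
    rw [← withDensity_mul _ hD hm]
    have hfun : (D * fun z => D (F z) * J z / D z) = fun z => D (F z) * J z := by
      funext z
      simp only [Pi.mul_apply]
      rw [mul_comm, ENNReal.div_mul_cancel (hD0 z) (hDtop z)]
    rw [hfun]
    exact h.map_withDensity hD

/-- **Change of the reference density, a.e. form.**  The same with `0 < D < ∞` only `μ`-almost
everywhere. -/
theorem HasJacobian.withDensity_of_pos_ae (h : HasJacobian μ F J) {D : Ω → ℝ≥0∞} (hD : Measurable D)
    (hD0 : ∀ᵐ z ∂μ, D z ≠ 0) (hDtop : ∀ᵐ z ∂μ, D z ≠ ∞) :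
    HasJacobian (μ.withDensity D) F fun z => D (F z) * J z / D z where
  measurable := h.measurable
  measurable_jac := ((hD.comp h.measurable).mul h.measurable_jac).div hD
  map_eq := by
    have hm : Measurable fun z => D (F z) * J z / D z := ((hD.comp h.measurable).mul h.measurable_jac).div hD
    rw [← withDensity_mul _ hD hm]
    have hfun : (D * fun z => D (F z) * J z / D z) =ᵐ[μ] fun z => D (F z) * J z := by
      filter_upwards [hD0, hDtop] with z h0 htop
      simp only [Pi.mul_apply]
      rw [mul_comm, ENNReal.div_mul_cancel h0 htop]
    rw [withDensity_congr_ae hfun]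
    exact h.map_withDensity hD

end Summit.Ventures.LatticeQCDFlow.Exactness
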